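import Summits.BirchSwinnertonDyer.BirchSwinnertonDyer.Theorems.CMKolyvaginAtInertTwoPairDataAtTwo
import HarnessLib

/-!
# Route `CMKolyvaginAtInertTwo`, crux `CMKolyvaginExactAtInertTwo` (stmt-BirchSwinnertonDyer-24277):
# THE EIGEN-PAIR CURRENCY AT `p = 2`, III: the embedding `V → H¹(K, E[2^M])`, pure classes, and
# the strict conditions `pairA` read in `H¹(K, E[2^M])` (plumbing for the Čebotarev binder T4c)

Seat `bsd-line-cmk2-p1` g13 (cell `bsd-print-cf2`); helper (`--supports stmt-BirchSwinnertonDyer-24277`).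
One definition (`pairEmb`, the sum map `(u, v) ↦ u + v`, whose kernel is `pairDelta`) and lemmas; no
named fact, no `sorry`; no item is closed; BSD is not proved by this.

A class of `V = H¹(K,E[2^M])^{ε} × H¹(K,E[2^M])^{−ε}` is PURE when one component vanishes (every
element of an eigengroup `pairEig ε (±1)` is pure). For pure `v`: `c_* (pairEmb v) = sgn(v) • pairEmb v`
with `sgn v = ε` if `v.2 = 0` and `−ε` otherwise; `pairEmb` is injective on pure classes and preserves
their order; and `v ∈ pairA ℓ ⟺ pairEmb v` vanishes at `λ = (ℓ)` (`torsionLocalKer`). These are the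
translations used to feed the Čebotarev leaf (p669091, classes in `H¹(K, E[2^M])`) from the telescope's
binder `hCeb₂` (classes in `V`). References: [GrossLMS1991] §5 (5.1), Prop. 5.4 (2); [McCallumLMS1991]
§3 (3); [Kolyvagin1989Izv] §3.
-/

-- single-conjunct summit: `Summit.BirchSwinnertonDyer.BirchSwinnertonDyer.…` repeats the name by design
set_option linter.dupNamespace false
set_option autoImplicit false

noncomputable section

open scoped Classical
open WeierstrassCurve NumberField IsDedekindDomain
open Literature.NumberTheory.GaloisRepresentations
open Literature.NumberTheory.EllipticCurves Literature.NumberTheory.EllipticCurves.KolyvaginDescent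

namespace Summit.BirchSwinnertonDyer.BirchSwinnertonDyer.Theorems.KolyvaginPairDataTwo

variable {N : ℕ} (W : WeierstrassCurve ℚ) {K : Type} [Field K] [NumberField K] (c : K ≃ₐ[ℚ] K) (M : ℕ)

/-- The sum map `V → H¹(K, E[2^M])`, `(u, v) ↦ u + v` (its kernel is `pairDelta`).
[cite: Kolyvagin1989Izv, §3] -/
def pairEmb (ε : ℤ) : PairV W c M ε →+ galH1Torsion (W.baseChange K) ((2 ^ M : ℕ) : ℤ) :=
  (eigK W c M ε).subtype.coprod (eigK W c M (-ε)).subtype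

/-- `pairEmb (u, v) = u + v`. [folklore] -/
theorem pairEmb_apply (ε : ℤ) (v : PairV W c M ε) :
    pairEmb W c M ε v = (v.1 : galH1Torsion (W.baseChange K) ((2 ^ M : ℕ) : ℤ)) + v.2 := by
  rw [pairEmb, AddMonoidHom.coprod_apply, AddSubgroup.coe_subtype, AddSubgroup.coe_subtype]

/-- `pairDelta = ker pairEmb`. [folklore] -/
theorem mem_pairDelta_iff_pairEmb (ε : ℤ) (v : PairV W c M ε) :
    v ∈ pairDelta W c M ε ↔ pairEmb W c M ε v = 0 :=
  Iff.rfl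

/-- Elements of the eigengroups are PURE: one component vanishes. [folklore] -/
theorem snd_eq_zero_or_fst_eq_zero_of_mem_pairEig (ε : ℤ) {s : ℤ} {v : PairV W c M ε}
    (hv : v ∈ pairEig W c M ε s) : v.2 = 0 ∨ v.1 = 0 := by
  by_cases h1 : s = ε
  · rw [h1, pairEig_self, AddSubgroup.mem_prod] at hv
    exact Or.inl (AddSubgroup.mem_bot.mp hv.2)
  by_cases h2 : s = -ε
  · rw [pairEig, if_neg h1, if_pos h2, AddSubgroup.mem_prod] at hv
    exact Or.inr (AddSubgroup.mem_bot.mp hv.1)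
  · rw [pairEig, if_neg h1, if_neg h2, AddSubgroup.mem_bot] at hv
    exact Or.inl (by rw [hv]; rfl)

/-- A pure class lies in the eigengroup of its sign `sgn v` (`ε` if `v.2 = 0`, else `−ε`). [folklore] -/
theorem mem_pairEig_sgn {ε : ℤ} (hε : ε = 1 ∨ ε = -1) {v : PairV W c M ε} (hv : v.2 = 0 ∨ v.1 = 0) :
    v ∈ pairEig W c M ε (if v.2 = 0 then ε else -ε) := by
  by_cases h : v.2 = 0
  · rw [if_pos h, pairEig_self, AddSubgroup.mem_prod]
    exact ⟨AddSubgroup.mem_top _, by rw [h]; exact zero_mem _⟩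
  · rw [if_neg h, pairEig_neg W c M hε, AddSubgroup.mem_prod]
    rcases hv with hv | hv
    · exact absurd hv h
    · exact ⟨by rw [hv]; exact zero_mem _, AddSubgroup.mem_top _⟩

/-- The sign of a NON-ZERO class of `pairEig ε s` (`s = ±1`) is `s`. [folklore] -/
theorem sgn_eq_of_mem_pairEig {ε : ℤ} (hε : ε = 1 ∨ ε = -1) {s : ℤ} (hs : s = 1 ∨ s = -1)
    {v : PairV W c M ε} (hv : v ∈ pairEig W c M ε s) (hv0 : v ≠ 0) :
    (if v.2 = 0 then ε else -ε) = s := by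
  by_cases h1 : s = ε
  · rw [h1, pairEig_self, AddSubgroup.mem_prod] at hv
    rw [if_pos (AddSubgroup.mem_bot.mp hv.2), h1]
  · have h2 : s = -ε := by
      rcases hε with rfl | rfl <;> rcases hs with rfl | rfl <;> simp_all
    rw [h2, pairEig_neg W c M hε, AddSubgroup.mem_prod] at hv
    have hv1 : v.1 = 0 := AddSubgroup.mem_bot.mp hv.1
    have hv2 : v.2 ≠ 0 := fun h ↦ hv0 (Prod.ext hv1 h)
    rw [if_neg hv2, h2]

/-- **Gross Prop. 5.4 (2) on the image**: for a pure class, `c_* (pairEmb v) = sgn(v) • pairEmb v`.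
[cite: GrossLMS1991, §5 (5.1), Prop. 5.4 (2)] -/
theorem conjAct_pairEmb {ε : ℤ} {v : PairV W c M ε} (hv : v.2 = 0 ∨ v.1 = 0) :
    conjAct W c ((2 ^ M : ℕ) : ℤ) (pairEmb W c M ε v) = (if v.2 = 0 then ε else -ε) • pairEmb W c M ε v := by
  rw [pairEmb_apply]
  by_cases h : v.2 = 0
  · rw [if_pos h, h, ZeroMemClass.coe_zero, add_zero]
    exact (mem_eigK_iff W c M ε _).mp v.1.2
  · rcases hv with hv | hv
    · exact absurd hv h
    · rw [if_neg h, hv, ZeroMemClass.coe_zero, zero_add]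
      exact (mem_eigK_iff W c M (-ε) _).mp v.2.2

/-- `pairEmb` is injective on each eigengroup (its kernel `pairDelta` meets them trivially). [folklore] -/
theorem eq_zero_of_pairEmb_eq_zero {ε : ℤ} (hε : ε = 1 ∨ ε = -1) {s : ℤ} {v : PairV W c M ε}
    (hv : v ∈ pairEig W c M ε s) (h0 : pairEmb W c M ε v = 0) : v = 0 :=
  eq_zero_of_mem_pairDelta_of_mem_pairEig W c M hε v h0 s hv

/-- `pairEmb` preserves the order of pure classes. [folklore] -/
theorem addOrderOf_pairEmb {ε : ℤ} {v : PairV W c M ε} (hv : v.2 = 0 ∨ v.1 = 0) :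
    addOrderOf (pairEmb W c M ε v) = addOrderOf v := by
  rw [pairEmb_apply]
  rcases hv with hv | hv
  · have : v = (v.1, 0) := Prod.ext rfl hv
    rw [hv, ZeroMemClass.coe_zero, add_zero, AddSubgroup.addOrderOf_coe]
    conv_rhs => rw [this, Prod.addOrderOf_mk, addOrderOf_zero, Nat.lcm_one_right]
  · have : v = (0, v.2) := Prod.ext hv rfl
    rw [hv, ZeroMemClass.coe_zero, zero_add, AddSubgroup.addOrderOf_coe]
    conv_rhs => rw [this, Prod.addOrderOf_mk, addOrderOf_zero, Nat.lcm_one_left]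

/-- Membership in the strict condition `pairA ℓ` at a Kolyvagin prime: both components vanish at
`λ = (ℓ)`. [cite: McCallumLMS1991, §3 (3)] -/
theorem mem_pairA_iff [NeZero N] [W.IsElliptic] {ε : ℤ} {ℓ : ℕ} (hℓ : IsKolyvaginPrime N W K 2 ℓ)
    (v : PairV W c M ε) :
    v ∈ pairA (N := N) W c M ε ℓ ↔
      (v.1 : galH1Torsion (W.baseChange K) ((2 ^ M : ℕ) : ℤ)) ∈
          (W.baseChange K).torsionLocalKer (hℓ.place.adicCompletion K) ((2 ^ M : ℕ) : ℤ) ∧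
        (v.2 : galH1Torsion (W.baseChange K) ((2 ^ M : ℕ) : ℤ)) ∈
          (W.baseChange K).torsionLocalKer (hℓ.place.adicCompletion K) ((2 ^ M : ℕ) : ℤ) := by
  rw [pairA, dif_pos hℓ, AddSubgroup.mem_prod, AddSubgroup.mem_comap, AddSubgroup.mem_comap,
    AddSubgroup.coe_subtype, AddSubgroup.coe_subtype]

/-- If `v ∈ pairA ℓ` then `pairEmb v` vanishes at `λ`. [cite: McCallumLMS1991, §3 (3)] -/
theorem pairEmb_mem_torsionLocalKer_of_mem_pairA [NeZero N] [W.IsElliptic] {ε : ℤ} {ℓ : ℕ}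
    (hℓ : IsKolyvaginPrime N W K 2 ℓ) {v : PairV W c M ε} (hv : v ∈ pairA (N := N) W c M ε ℓ) :
    pairEmb W c M ε v ∈ (W.baseChange K).torsionLocalKer (hℓ.place.adicCompletion K) ((2 ^ M : ℕ) : ℤ) := by
  rw [mem_pairA_iff W c M hℓ] at hv
  rw [pairEmb_apply]
  exact add_mem hv.1 hv.2

/-- A PURE class whose image vanishes at `λ` lies in `pairA ℓ`. [cite: McCallumLMS1991, §3 (3)] -/
theorem mem_pairA_of_pairEmb_mem [NeZero N] [W.IsElliptic] {ε : ℤ} {ℓ : ℕ}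
    (hℓ : IsKolyvaginPrime N W K 2 ℓ) {v : PairV W c M ε} (hpure : v.2 = 0 ∨ v.1 = 0)
    (hv : pairEmb W c M ε v ∈ (W.baseChange K).torsionLocalKer (hℓ.place.adicCompletion K) ((2 ^ M : ℕ) : ℤ)) :
    v ∈ pairA (N := N) W c M ε ℓ := by
  rw [mem_pairA_iff W c M hℓ]
  rw [pairEmb_apply] at hv
  rcases hpure with h | h
  · rw [h, ZeroMemClass.coe_zero, add_zero] at hv
    exact ⟨hv, by rw [h, ZeroMemClass.coe_zero]; exact zero_mem _⟩
  · rw [h, ZeroMemClass.coe_zero, zero_add] at hv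
    exact ⟨by rw [h, ZeroMemClass.coe_zero]; exact zero_mem _, hv⟩

/-- A `ℤ`-multiple of a pure class is pure (same vanishing component). [folklore] -/
theorem pure_zsmul {ε : ℤ} {v : PairV W c M ε} (hv : v.2 = 0 ∨ v.1 = 0) (k : ℤ) :
    (k • v).2 = 0 ∨ (k • v).1 = 0 := by
  rcases hv with h | h
  · left
    change k • v.2 = 0
    rw [h, zsmul_zero]
  · right
    change k • v.1 = 0
    rw [h, zsmul_zero]

/-- An element of the subgroup generated by pure classes of a fixed vanishing component has the
same vanishing component. [folklore] -/
theorem snd_eq_zero_of_mem_closure {ε : ℤ} {X : Set (PairV W c M ε)} (hX : ∀ x ∈ X, x.2 = 0)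
    {v : PairV W c M ε} (hv : v ∈ AddSubgroup.closure X) : v.2 = 0 := by
  induction hv using AddSubgroup.closure_induction with
  | mem x hx => exact hX x hx
  | zero => rfl
  | add x y _ _ hx hy => change x.2 + y.2 = 0; rw [hx, hy, add_zero]
  | neg x _ hx => change -x.2 = 0; rw [hx, neg_zero]

/-- Companion of `snd_eq_zero_of_mem_closure` for the first component. [folklore] -/
theorem fst_eq_zero_of_mem_closure {ε : ℤ} {X : Set (PairV W c M ε)} (hX : ∀ x ∈ X, x.1 = 0)
    {v : PairV W c M ε} (hv : v ∈ AddSubgroup.closure X) : v.1 = 0 := by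
  induction hv using AddSubgroup.closure_induction with
  | mem x hx => exact hX x hx
  | zero => rfl
  | add x y _ _ hx hy => change x.1 + y.1 = 0; rw [hx, hy, add_zero]
  | neg x _ hx => change -x.1 = 0; rw [hx, neg_zero]

end Summit.BirchSwinnertonDyer.BirchSwinnertonDyer.Theorems.KolyvaginPairDataTwo
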